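import Summits.RiemannHypothesis.RiemannHypothesis.Theorems.WeilCombCombShapePositivityWidthRigidity
import Mathlib

/-!
# Width rigidity III — countably many widths suffice: `stub_widthRigidityInfinite`

Registered helper of the crux `WeilComb.CombShapePositivity` (item stmt-RiemannHypothesis-11229, route
route-RiemannHypothesis-WeilComb, line `Sketch`, stub-plan `Cruxes/CombShapePositivity/STUB-PLAN-stub_fejer.md`; sprove
seat c1). A theorem ABOUT the RH-equivalent input, not a step of `CombShapePositivity_of`.

From the finite form of width rigidity (`stub_widthRigidityFinite`, file `…WidthRigidity.lean`: if RH fails then below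
any bound only finitely many widths `ε` carry every cell `(M, a)` of the crux):

* `stub_widthRigidityInfinite`: the cells of the crux at every width of an INFINITE BOUNDED set `E ⊆ (0, R]` already
  give `RiemannHypothesis`;
* `riemannHypothesis_iff_cruxAt_one_add_inv`: **RH ⟺ the crux at the countably many widths `1 + 1/(k+1)`, `k ∈ ℕ`**;
* `riemannHypothesis_iff_fejer_two_three_one_add_inv`: the same in Bohr–Fejér coordinates on the torus `T²_{2,3}`.

Statements are spelled out verbatim (no local notation): the cell of width `ε`, level `M`, coefficients `a` is
`0 ≤ Re Q(Σ_{m ≤ M} a_m ε⁻¹φ₀((· − log m)/ε))`, `φ₀(u) = expNegInvGlue (1 − u²)`, `Q = weilQuadratic`.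
-/

noncomputable section

-- the sub-problem path RiemannHypothesis/RiemannHypothesis duplicates a namespace (D-0017)
set_option linter.dupNamespace false

open scoped BigOperators ComplexConjugate Real Topology
open Complex MeasureTheory Set Filter

namespace Summit.RiemannHypothesis.RiemannHypothesis.Theorems.WeilCombBohrFejer

open Literature.NumberTheory.LFunctions

/-- **`stub_widthRigidityInfinite` — an infinite BOUNDED set of widths is RH-complete** (registered helper).
If every cell `(M, a)` of the crux holds at each width of an infinite set `E ⊆ (0, R]`, the Riemann
hypothesis follows (otherwise `E` would lie in the finite set of `stub_widthRigidityFinite`). [folklore] -/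
theorem stub_widthRigidityInfinite : ∀ E : Set ℝ, E.Infinite → (∃ R : ℝ, ∀ ε ∈ E, ε ≤ R) →
    (∀ ε ∈ E, 0 < ε ∧ ∀ (M : ℕ) (a : ℕ → ℂ),
      0 ≤ (weilQuadratic (fun x : ℝ => ∑ m ∈ Finset.Icc 1 M,
        a m * ((ε : ℂ)⁻¹ * ((expNegInvGlue (1 - ((x - Real.log (m : ℝ)) / ε) ^ 2) : ℝ) : ℂ)))).re) →
    RiemannHypothesis := by
  intro E hE hR h
  by_contra hRH
  obtain ⟨R, hR⟩ := hR
  exact hE ((stub_widthRigidityFinite hRH R).subset fun ε hε => ⟨(h ε hε).1, hR ε hε, (h ε hε).2⟩)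

/-- The widths `1 + 1/(k+1)` are pairwise distinct. [folklore] -/
theorem injective_one_add_inv_succ : Function.Injective fun k : ℕ => (1 : ℝ) + 1 / ((k : ℝ) + 1) := by
  intro k l hkl
  have h1 : (1 : ℝ) / ((k : ℝ) + 1) = 1 / ((l : ℝ) + 1) := by simpa using hkl
  rw [div_eq_div_iff (by positivity) (by positivity), one_mul, one_mul] at h1
  exact_mod_cast (by linarith : (k : ℝ) = l)

/-- **RH ⟺ the crux at the countably many widths `1 + 1/(k+1)`, `k ∈ ℕ`** (every cell `(M, a)` at each
of these widths; any injective bounded sequence of positive widths would do). [folklore] -/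
theorem riemannHypothesis_iff_cruxAt_one_add_inv :
    RiemannHypothesis ↔ ∀ (k M : ℕ) (a : ℕ → ℂ),
      0 ≤ (weilQuadratic (fun x : ℝ => ∑ m ∈ Finset.Icc 1 M,
        a m * ((((1 + 1 / ((k : ℝ) + 1) : ℝ)) : ℂ)⁻¹ *
          ((expNegInvGlue (1 - ((x - Real.log (m : ℝ)) / (1 + 1 / ((k : ℝ) + 1))) ^ 2) : ℝ) : ℂ)))).re := by
  constructor
  · intro hRH k M a
    exact cruxAt_of_riemannHypothesis hRH _ (by positivity) M a
  · intro h
    refine stub_widthRigidityInfinite (Set.range fun k : ℕ => (1 : ℝ) + 1 / ((k : ℝ) + 1))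
      (Set.infinite_range_of_injective injective_one_add_inv_succ) ⟨2, ?_⟩ ?_
    · rintro ε ⟨k, rfl⟩
      have hk : (1 : ℝ) / ((k : ℝ) + 1) ≤ 1 := by
        rw [div_le_one (by positivity)]
        linarith [(Nat.cast_nonneg k : (0 : ℝ) ≤ k)]
      show (1 : ℝ) + 1 / ((k : ℝ) + 1) ≤ 2
      linarith
    · rintro ε ⟨k, rfl⟩
      exact ⟨by positivity, fun M a => h k M a⟩

/-- **Fejér form**: RH ⟺ the Fejér faces on the torus `T²_{2,3}` are non-negative at the widths
`1 + 1/(k+1)`, `k ∈ ℕ` (all levels `n`, all angles `θ`) — by the fixed-width collapse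
`cruxAt_iff_fejer_two_three`. [folklore] -/
theorem riemannHypothesis_iff_fejer_two_three_one_add_inv :
    RiemannHypothesis ↔ ∀ (k n : ℕ) (θ : ℕ → ℝ),
      0 ≤ (∑ d ∈ (∏ p ∈ ({2, 3} : Finset ℕ), p ^ n).divisors,
          ∑ d' ∈ (∏ p ∈ ({2, 3} : Finset ℕ), p ^ n).divisors,
        Complex.exp (I * ((∑ p ∈ ({2, 3} : Finset ℕ), θ p * (d.factorization p : ℝ) : ℝ) : ℂ)) *
          conj (Complex.exp (I * ((∑ p ∈ ({2, 3} : Finset ℕ), θ p * (d'.factorization p : ℝ) : ℝ) : ℂ))) *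
          weilFunctional (weilTranslate
            (weilConv (fun t : ℝ => (((1 + 1 / ((k : ℝ) + 1) : ℝ)) : ℂ)⁻¹ *
                ((expNegInvGlue (1 - (t / (1 + 1 / ((k : ℝ) + 1))) ^ 2) : ℝ) : ℂ))
              (weilReflect (fun t : ℝ => (((1 + 1 / ((k : ℝ) + 1) : ℝ)) : ℂ)⁻¹ *
                ((expNegInvGlue (1 - (t / (1 + 1 / ((k : ℝ) + 1))) ^ 2) : ℝ) : ℂ))))
            (Real.log (d : ℝ) - Real.log (d' : ℝ)))).re := by
  rw [riemannHypothesis_iff_cruxAt_one_add_inv]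
  constructor
  · intro h k n θ
    exact (cruxAt_iff_fejer_two_three (ε := 1 + 1 / ((k : ℝ) + 1)) (by positivity)).1
      (fun M a => h k M a) n θ
  · intro h k M a
    exact (cruxAt_iff_fejer_two_three (ε := 1 + 1 / ((k : ℝ) + 1)) (by positivity)).2 (h k) M a

end Summit.RiemannHypothesis.RiemannHypothesis.Theorems.WeilCombBohrFejer

end
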